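import Literature.AlgebraicGeometry.Motives.AbelianVarietyWeilPairingLevel
import HarnessLib

/-!
# The level Weil pairing is alternating: `ē_N^Θ(P, P) = 1` (Lang VII §2, Thm. 5 (i); Milne §16, Lemma 16.2 (e))

Let `A` be an abelian variety over a field `K`, `Θ` a Cartier divisor on `A`, `N` a natural number
with `[N]_A` dominant, and `P ∈ A[N](K)` an `N`-torsion point which is an `N`-th power in `A(K)`
(`P = Q^N`; automatic over `K = K̄` with `N` invertible, where `A(K)` is divisible). Then the
level-`N` Weil pairing of `Motives/AbelianVarietyWeilPairingLevel` satisfies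

  `ē_N^Θ(P, P) = e_N(P, t_P^* Θ - Θ) = 1`        (`weilPairingLevel_self_of_eq_pow`),

hence is **skew-symmetric**, `ē_N^Θ(P, Q) · ē_N^Θ(Q, P) = 1` (`weilPairingLevel_mul_swap_eq_one`),
by bimultiplicativity. This is Lang, *Abelian Varieties*, Ch. VII §2, Thm. 5 (i) ("`E_n(a, b)` is
skew-symmetric") via Prop. 6–7, Milne, *Abelian varieties* (1986), §16, Lemma 16.2 (e)
("`L ↦ e_l^L ∈ Hom(Λ² T_l A, ℤ_l(1))`", proof referred to Mumford §20, Thm. 1 and §23) — the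
property `self_eq_one` consumed by the passage to the Tate module
(`Literature.NumberTheory.DiophantineGeometry.LevelWeilPairing`).

## The proof formalised here

We do not follow Mumford's theta-group proof. Instead we use the elementary telescoping argument
familiar from the elliptic-curve case (Silverman, *The Arithmetic of Elliptic Curves*, III §8,
Prop. 8.1 (c): "`e_m(T, T) = 1` … `∏_{i=0}^{m-1} f ∘ τ_{[i]T}` is constant …
`∏ g ∘ τ_{[i]T'}` … `g(X + T) = g(X)`"), which transposes verbatim to `D_P = t_P^* Θ - Θ` on an
abelian variety:

1. `IsTrivializer.translFF` — if `g` trivializes `[N]^* E` then `t_Q^♯ g` trivializes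
   `[N]^* t_{Q^N}^* E` (`t_Q ≫ [N] = [N] ≫ t_{Q^N}`, `translation_comp_zsmul_id`);
2. `isTrivializer_weilDiv_pow_prod` — with `g = g_P` the Weil function of `D_P`
   (`[N]^* D_P + div g_P = 0`) and `Q^N = P`, the product `h_m = ∏_{i<m} t_{Q^i}^♯ g_P` trivializes
   `[N]^* D_{P^m}`, because `∑_{i<m} t_{P^i}^* D_P = ∑_{i<m} (t_{P^{i+1}}^* Θ - t_{P^i}^* Θ)`
   **telescopes** to `t_{P^m}^* Θ - Θ = D_{P^m}` (as Cartier divisors, `telescope_sameDivisor`);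
3. at `m = N`, `D_{P^N} = D_1 ∼ 0` on the nose, so `h_N` is a unit at every point of `A`, hence a
   constant (`Γ(A, 𝒪_A) = K`), hence fixed by `t_Q^♯` (`translFF_eq_self_of_forall_isUnitAt`);
4. but `t_Q^♯ h_N · g_P = h_N · t_{Q^N}^♯ g_P = h_N · t_P^♯ g_P`, so `t_P^♯ g_P = g_P`, i.e.
   `ē_N^Θ(P, P) = t_P^♯ g_P / g_P = 1`.

Everything is proved; no named facts (D-0026). Towards the named fact
`Literature.NumberTheory.DiophantineGeometry.weilPairing_rationalTateModule` (its hypothesis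
structure `LevelWeilPairing`, field `self_eq_one`).

## References

* [Lang1983AbelianVarieties] S. Lang, *Abelian Varieties* (1959/1983), Ch. VII §2, Props. 6–7 and
  Thm. 5 (i) (PDF pp. 140–142).
* [Milne1986AbelianVarieties] J. S. Milne, *Abelian varieties*, in Cornell–Silverman (eds.),
  *Arithmetic Geometry* (1986), §16, Lemma 16.2 (e) (PDF p. 200).
* [MumfordAV1970] D. Mumford, *Abelian Varieties* (1970), §20, Thm. 1 and (5) p. 184; §23.
* [SilvermanAEC2009] J. H. Silverman, *The Arithmetic of Elliptic Curves*, 2nd ed. (2009), III §8,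
  Prop. 8.1 (c) and its proof (the telescoping-product argument).
-/

universe u

open CategoryTheory CategoryTheory.Limits AlgebraicGeometry MonoidalCategory CartesianMonoidalCategory

noncomputable section

namespace Literature.AlgebraicGeometry.Motives

open scoped MonObj
open RatFn

/-! ### A telescoping identity of Cartier divisors -/

namespace CartierDivisor

variable {X : Scheme.{u}} [IsIntegral X]

/-- **Telescoping**: `(D - E) + (F - D') = F - E` as Cartier divisors when `D` and `D'` are the
same divisor. [folklore] -/
theorem telescope_sameDivisor {D D' : CartierDivisor X} (E F : CartierDivisor X)
    (h : D.SameDivisor D') : (D + -E + (F + -D')).SameDivisor (F + -E) := by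
  have h1 : (D + -E + (F + -D')).SameDivisor (D + F + (-E + -D')) :=
    add_add_add_comm_sameDivisor D (-E) F (-D')
  have h2 : (D + F + (-E + -D')).SameDivisor (F + D + (-D' + -E)) :=
    (add_comm_sameDivisor D F).add (add_comm_sameDivisor (-E) (-D'))
  have h3 : (F + D + (-D' + -E)).SameDivisor (F + D + -D' + -E) :=
    (add_assoc_sameDivisor (F + D) (-D') (-E)).symm
  have h4 : (F + D + -D' + -E).SameDivisor (F + (D + -D') + -E) :=
    (add_assoc_sameDivisor F D (-D')).add (SameDivisor.refl _)
  have h5 : (F + (D + -D') + -E).SameDivisor (F + 0 + -E) :=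
    ((SameDivisor.refl F).add ((h.add (SameDivisor.refl (-D'))).trans (add_neg_sameDivisor D'))).add
      (SameDivisor.refl _)
  have h6 : (F + 0 + -E).SameDivisor (F + -E) := (add_zero_sameDivisor F).add (SameDivisor.refl _)
  exact ((((h1.trans h2).trans h3).trans h4).trans h5).trans h6

end CartierDivisor

namespace AbelianVariety

variable {K : Type u} [Field K] {A : AbelianVariety K}

section Level

variable {N : ℕ} [IsDominant (Hom.toSchemeHom ((N : ℤ) • 𝟙 A))]

/-! ### Trivializers: transport and translation -/

/-- **Transport of trivializers along `SameDivisor`**: if `h` trivializes `[N]^* E` and `E`, `E'`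
are the same divisor, then `h` trivializes `[N]^* E'` (`[N]^♯ (f_i / f'_j)` is a unit on
`[N]⁻¹(U_i ∩ U'_j)`). [folklore] -/
theorem IsTrivializer.of_sameDivisor {E E' : CartierDivisor A.X.left} {h : A.X.left.functionField}
    (hh : A.IsTrivializer (n := N) E h) (H : E.SameDivisor E') : A.IsTrivializer (n := N) E' h := by
  refine ⟨hh.1, fun j x hj => ?_⟩
  obtain ⟨i, hi⟩ := E.covers ((Hom.toSchemeHom ((N : ℤ) • 𝟙 A)) x)
  have h1 : IsUnitAt x (functionFieldMap (Hom.toSchemeHom ((N : ℤ) • 𝟙 A)) (E.f i) * h) :=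
    hh.2 i x hi
  have h2 : IsUnitAt x (functionFieldMap (Hom.toSchemeHom ((N : ℤ) • 𝟙 A)) (E.f i / E'.f j)) :=
    (H i j _ hi hj).functionFieldMap
  have hfi : functionFieldMap (Hom.toSchemeHom ((N : ℤ) • 𝟙 A)) (E.f i) ≠ 0 :=
    (map_ne_zero _).2 (E.f_ne_zero i)
  have hfj : functionFieldMap (Hom.toSchemeHom ((N : ℤ) • 𝟙 A)) (E'.f j) ≠ 0 :=
    (map_ne_zero _).2 (E'.f_ne_zero j)
  convert h1.div h2 using 1
  rw [map_div₀]
  field_simp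

/-- **Translating a trivializer**: if `g` trivializes `[N]^* E` then `t_Q^♯ g` trivializes
`[N]^* (t_{Q^N}^* E) = t_Q^* [N]^* E` for any rational point `Q` (`t_Q ≫ [N] = [N] ≫ t_{Q^N}`,
`translation_comp_zsmul_id`; Lang VII §2, proof of Prop. 5 and Silverman III §8: "`g ∘ τ_{T'}`").
[cite: Lang1983AbelianVarieties, Ch. VII §2 (proof of Prop. 5)] -/
theorem IsTrivializer.translFF {E : CartierDivisor A.X.left} {g : A.X.left.functionField}
    (hg : A.IsTrivializer (n := N) E g) (Q : A.Points K) :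
    A.IsTrivializer (n := N) (E.pullback (A.translation (Q ^ N)).left) (A.translFF Q g) := by
  refine ⟨(map_ne_zero _).2 hg.1, fun i x hi => ?_⟩
  have hcomm : (A.translation Q).left ≫ Hom.toSchemeHom ((N : ℤ) • 𝟙 A) =
      Hom.toSchemeHom ((N : ℤ) • 𝟙 A) ≫ (A.translation (Q ^ N)).left :=
    congrArg CommaMorphism.left (A.translation_comp_zsmul_id Q N)
  have hi' : Hom.toSchemeHom ((N : ℤ) • 𝟙 A) ((A.translation Q).left x) ∈ E.U i := by
    rw [← Scheme.Hom.comp_apply, hcomm, Scheme.Hom.comp_apply]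
    exact hi
  have h1 : IsUnitAt x (A.translFF Q
      (functionFieldMap (Hom.toSchemeHom ((N : ℤ) • 𝟙 A)) (E.f i) * g)) :=
    (hg.2 i _ hi').functionFieldMap
  rw [map_mul] at h1
  convert h1 using 2
  rw [CartierDivisor.pullback_f, translFF_functionFieldMap_zsmul']

/-! ### The telescoping product `∏_{i<m} t_{Q^i}^♯ g_P` -/

/-- `D_1` is the zero divisor on the nose: `t_1^* Θ - Θ = Θ - Θ = 0` as Cartier divisors.
[folklore] -/
theorem weilDiv_one_sameDivisor_zero (Θ : CartierDivisor A.X.left) : (A.weilDiv Θ 1).SameDivisor 0 := by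
  haveI : IsDominant (𝟙 A.X.left) := inferInstance
  have e : (A.translation (1 : A.Points K)).left = 𝟙 A.X.left := by rw [translation_one]; rfl
  exact (((Θ.pullback_congr_sameDivisor e).trans Θ.pullback_id_sameDivisor).add
    (CartierDivisor.SameDivisor.refl _)).trans (CartierDivisor.add_neg_sameDivisor Θ)

/-- **One telescoping step**: `D_{P^m} + t_{P^m}^* D_P = D_{P^{m+1}}` as Cartier divisors
(`t_{P^m}^* t_P^* Θ = t_{P^{m+1}}^* Θ` and `t_{P^m}^* Θ` cancels). [folklore] -/
theorem weilDiv_pow_add_pullback_sameDivisor (Θ : CartierDivisor A.X.left) (P : A.Points K) (m : ℕ) :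
    (A.weilDiv Θ (P ^ m) + (A.weilDiv Θ P).pullback (A.translation (P ^ m)).left).SameDivisor
      (A.weilDiv Θ (P ^ (m + 1))) := by
  have hcomp : (A.translation (P ^ m)).left ≫ (A.translation P).left =
      (A.translation (P ^ (m + 1))).left := by
    rw [← Over.comp_left, translation_comp, ← pow_succ']
  haveI : IsDominant ((A.translation (P ^ m)).left ≫ (A.translation P).left) := inferInstance
  have h1 : ((A.weilDiv Θ P).pullback (A.translation (P ^ m)).left).SameDivisor
      (Θ.pullback (A.translation (P ^ (m + 1))).left + -(Θ.pullback (A.translation (P ^ m)).left)) := by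
    refine (CartierDivisor.pullback_add_sameDivisor _ _ _).trans
      (CartierDivisor.SameDivisor.add ?_ (CartierDivisor.pullback_neg_sameDivisor _ Θ))
    exact (Θ.pullback_pullback_sameDivisor _ _).trans (Θ.pullback_congr_sameDivisor hcomp)
  exact ((CartierDivisor.SameDivisor.refl _).add h1).trans
    (CartierDivisor.telescope_sameDivisor Θ _ (CartierDivisor.SameDivisor.refl _))

/-- **The telescoping product trivializes `[N]^* D_{P^m}`**: for `P ∈ A[N](K)` with `P = Q^N` and
`g_P` the Weil function of `D_P = t_P^* Θ - Θ` (`[N]^* D_P + div g_P = 0`), the rational function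
`h_m = ∏_{i<m} t_{Q^i}^♯ g_P` trivializes `[N]^* D_{P^m}`, since `t_{Q^i}^♯ g_P` trivializes
`[N]^* t_{P^i}^* D_P` and `∑_{i<m} t_{P^i}^* D_P = D_{P^m}` telescopes (Silverman III §8, proof of
Prop. 8.1 (c): "`div(∏ f ∘ τ_{[i]T}) = 0`"). [cite: SilvermanAEC2009, III §8 Prop. 8.1 (c) (proof)] -/
theorem isTrivializer_weilDiv_pow_prod (Θ : CartierDivisor A.X.left) (P : A.torsionPoints K N)
    {Q : A.Points K} (hQ : Q ^ N = P.1) (m : ℕ) :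
    A.IsTrivializer (n := N) (A.weilDiv Θ (P.1 ^ m))
      (∏ i ∈ Finset.range m, A.translFF (Q ^ i) (A.weilFn Θ P)) := by
  induction m with
  | zero =>
    rw [Finset.prod_range_zero, pow_zero]
    exact isTrivializer_zero.of_sameDivisor (A.weilDiv_one_sameDivisor_zero Θ).symm
  | succ m ih =>
    rw [Finset.prod_range_succ]
    have hQm : (Q ^ m) ^ N = P.1 ^ m := by rw [← pow_mul, mul_comm, pow_mul, hQ]
    have e : (A.translation ((Q ^ m) ^ N)).left = (A.translation (P.1 ^ m)).left := by rw [hQm]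
    have h2 : A.IsTrivializer (n := N) ((A.weilDiv Θ P.1).pullback (A.translation (P.1 ^ m)).left)
        (A.translFF (Q ^ m) (A.weilFn Θ P)) :=
      ((A.isTrivializer_weilFn Θ P).translFF (Q ^ m)).of_sameDivisor
        ((A.weilDiv Θ P.1).pullback_congr_sameDivisor e)
    exact (ih.add h2).of_sameDivisor (A.weilDiv_pow_add_pullback_sameDivisor Θ P.1 m)

/-- At `m = N` the telescoping product `h_N = ∏_{i<N} t_{Q^i}^♯ g_P` is a unit at every point
(`D_{P^N} = D_1 = 0`). [folklore] -/
theorem isUnitAt_weilFn_prod (Θ : CartierDivisor A.X.left) (P : A.torsionPoints K N)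
    {Q : A.Points K} (hQ : Q ^ N = P.1) (x : A.X.left) :
    IsUnitAt x (∏ i ∈ Finset.range N, A.translFF (Q ^ i) (A.weilFn Θ P)) := by
  have h := A.isTrivializer_weilDiv_pow_prod Θ P hQ N
  rw [coe_torsionPoints_pow_eq_one P] at h
  have h0 := (h.of_sameDivisor (A.weilDiv_one_sameDivisor_zero Θ)).2 PUnit.unit x
    (CartierDivisor.mem_zero_U _ _)
  rwa [CartierDivisor.zero_f, map_one, one_mul] at h0

/-- Translating the telescoping product shifts it by one:
`t_Q^♯ h_N · g_P = h_N · t_{Q^N}^♯ g_P` (`h_N = ∏_{i<N} t_{Q^i}^♯ g_P`). [folklore] -/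
theorem translFF_weilFn_prod_mul (Θ : CartierDivisor A.X.left) (P : A.torsionPoints K N)
    (Q : A.Points K) :
    A.translFF Q (∏ i ∈ Finset.range N, A.translFF (Q ^ i) (A.weilFn Θ P)) * A.weilFn Θ P =
      (∏ i ∈ Finset.range N, A.translFF (Q ^ i) (A.weilFn Θ P)) * A.translFF (Q ^ N) (A.weilFn Θ P) := by
  rw [map_prod]
  have e : ∀ i, A.translFF Q (A.translFF (Q ^ i) (A.weilFn Θ P)) =
      A.translFF (Q ^ (i + 1)) (A.weilFn Θ P) := fun i => by
    rw [pow_succ', translFF_mul, RingHom.comp_apply]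
  simp_rw [e]
  have h := Finset.prod_range_succ' (fun i => A.translFF (Q ^ i) (A.weilFn Θ P)) N
  rw [pow_zero, translFF_one, RingHom.id_apply] at h
  rw [← h, Finset.prod_range_succ]

/-- **The level Weil pairing is alternating** (Lang, *Abelian Varieties*, VII §2, Thm. 5 (i); Milne
1986, §16, Lemma 16.2 (e); Mumford §20, Thm. 1): for an `N`-torsion point `P = Q^N` which is an
`N`-th power in `A(K)`, `ē_N^Θ(P, P) = 1`. Proof: `h_N = ∏_{i<N} t_{Q^i}^♯ g_P` is an everywhere
unit, hence constant, hence `t_Q^♯ h_N = h_N`; with `t_Q^♯ h_N · g_P = h_N · t_P^♯ g_P` this gives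
`t_P^♯ g_P = g_P`. [cite: Lang1983AbelianVarieties, Ch. VII §2 Thm. 5 (i)] -/
theorem weilPairingLevel_self_of_eq_pow (Θ : CartierDivisor A.X.left) (P : A.torsionPoints K N)
    {Q : A.Points K} (hQ : Q ^ N = P.1) : A.weilPairingLevel Θ P P = 1 := by
  set h := ∏ i ∈ Finset.range N, A.translFF (Q ^ i) (A.weilFn Θ P) with hdef
  have hunit : ∀ x : A.X.left, IsUnitAt x h := A.isUnitAt_weilFn_prod Θ P hQ
  have hfix : A.translFF Q h = h := translFF_eq_self_of_forall_isUnitAt hunit Q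
  have hne : h ≠ 0 := (hunit (genericPoint A.X.left)).ne_zero
  have hprod := A.translFF_weilFn_prod_mul Θ P Q
  rw [← hdef, hfix, hQ] at hprod
  have hg : A.translFF P.1 (A.weilFn Θ P) = A.weilFn Θ P := (mul_left_cancel₀ hne hprod).symm
  apply (algebraMap K A.X.left.functionField).injective
  rw [weilPairingLevel, algebraMap_kummerConst, hg, div_self (A.isTrivializer_weilFn Θ P).1, map_one]

/-- **Skew-symmetry** `ē_N^Θ(P, Q) · ē_N^Θ(Q, P) = 1` (Lang VII §2, Thm. 5 (i): "`E_n(a, b)` is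
skew-symmetric"; Milne §16, Lemma 16.2 (e)), from alternation and bimultiplicativity:
`1 = ē(PQ, PQ) = ē(P, P) ē(P, Q) ē(Q, P) ē(Q, Q)`; the three points `P`, `Q`, `PQ` are assumed to
be `N`-th powers in `A(K)`. [cite: Lang1983AbelianVarieties, Ch. VII §2 Thm. 5 (i)] -/
theorem weilPairingLevel_mul_swap_eq_one (Θ : CartierDivisor A.X.left) (P Q : A.torsionPoints K N)
    (hP : ∃ R : A.Points K, R ^ N = P.1) (hQ : ∃ R : A.Points K, R ^ N = Q.1) :
    A.weilPairingLevel Θ P Q * A.weilPairingLevel Θ Q P = 1 := by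
  obtain ⟨R, hR⟩ := hP
  obtain ⟨S, hS⟩ := hQ
  have hRS : (R * S) ^ N = (P * Q).1 := by rw [mul_pow, hR, hS]; rfl
  have h := A.weilPairingLevel_self_of_eq_pow Θ (P * Q) hRS
  rw [weilPairingLevel_mul_left, weilPairingLevel_mul_right, weilPairingLevel_mul_right,
    A.weilPairingLevel_self_of_eq_pow Θ P hR, A.weilPairingLevel_self_of_eq_pow Θ Q hS, one_mul,
    mul_one] at h
  exact h

/-- Skew-symmetry, solved form: `ē_N^Θ(Q, P) = ē_N^Θ(P, Q)⁻¹`. [cite: Lang1983AbelianVarieties, Ch. VII §2 Thm. 5 (i)] -/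
theorem weilPairingLevel_swap (Θ : CartierDivisor A.X.left) (P Q : A.torsionPoints K N)
    (hP : ∃ R : A.Points K, R ^ N = P.1) (hQ : ∃ R : A.Points K, R ^ N = Q.1) :
    A.weilPairingLevel Θ Q P = (A.weilPairingLevel Θ P Q)⁻¹ :=
  eq_inv_of_mul_eq_one_right (A.weilPairingLevel_mul_swap_eq_one Θ P Q hP hQ)

/-- **Alternation for divisible `A(K)`** (e.g. `K` algebraically closed and `N` invertible in `K`):
if every rational point is an `N`-th power then `ē_N^Θ(P, P) = 1` for all `P ∈ A[N](K)`.
[cite: Lang1983AbelianVarieties, Ch. VII §2 Thm. 5 (i)] -/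
theorem weilPairingLevel_self (hdiv : Function.Surjective fun R : A.Points K => R ^ N)
    (Θ : CartierDivisor A.X.left) (P : A.torsionPoints K N) : A.weilPairingLevel Θ P P = 1 := by
  obtain ⟨Q, hQ⟩ := hdiv P.1
  exact A.weilPairingLevel_self_of_eq_pow Θ P hQ

end Level

end AbelianVariety

end Literature.AlgebraicGeometry.Motives
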